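import Literature.MathematicalPhysics.QuantumLattice.WeightedOpenClusterBoundsPeriodic
import Literature.MathematicalPhysics.QuantumLattice.PeriodicStatesMeanEntropy
import HarnessLib

/-!
# The Markov (conditional-entropy) bound on the mean entropy of superlattice-periodic infinite-volume lattice-fermion states,
# and the Markov cap on the periodic variational pressure `P_q` — windows attached to the sites of a multi-site cell

Topic `Literature/MathematicalPhysics/QuantumLattice` (family `hubbard`; crew hubbard-fast S2 «families of models … multi-band, T > 0», seat hubbard-box-p1).
`TorusMarkovPressureBound` / `FermionEntropyChainRule.vonNeumannEntropy_le_of_window_entropies` give the Markov-entropy-decomposition bound of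
[cite: PoulinHastings2011, eqs. (3)–(8)] for ONE window and a translation-invariant density matrix on a finite torus. The periodic variational pressure
`P_q(β,Ψ) = sup_ω [s̄(ω) − β ē_q(ω)]` of a DECORATED model (`perVarPressure`, `PeriodicVariationalPressure`; three-band `CuO₂`, ionic / staggered Hubbard
models) lives on INFINITE-VOLUME `q`-periodic states with a multi-site cell, and its only entropy caps in the tree so far are the aligned-box / tiling
bounds (`IsPeriodic.entropyDensitySup_le_boxEntropyDensity`), which force a TILING cluster. This file proves the conditional-entropy (SSA) version:

* §1 (finite `Ω`, even density matrix `ρ`) `vonNeumannEntropy_le_sum_cornerWindows`: for a set `K ⊆ Ω` of corner sites, each with a window `W x ⊆ Ω` of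
  which `x` is the lexicographically largest site, `S(ρ) ≤ Σ_{x ∈ K} [S_ρ(W x) − S_ρ(W x ∖ x)] + (|Ω| − |K|)·log 4` (chain rule + Araki–Moriya SSA at the
  corners, `log 4` elsewhere) — the multi-window form of `vonNeumannEntropy_le_of_window_entropies`.
* §2 (infinite volume) **`IsPeriodic.card_cell_mul_entropyDensitySup_le`**: for a `q`-periodic state `ω` (`d ≥ 1`), a set `T` of residue classes, and
  for each `c ∈ T` a representative corner `a c` (`res (a c) = c`) with a finite window `W c ∋ a c` of which it is the largest site:
  `|C| · s̄(ω) ≤ Σ_{c ∈ T} [S(ω|W c) − S(ω|W c ∖ a c)] + (|C| − |T|)·log 4` (`|C| = Π (q_i+1)` sites per cell; classes outside `T` are bounded by `log 4`).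
  Proof: §1 on the boxes `[−n, (k+1)n)^d` with all superlattice translates of the corners in `[0,kn)^d` (`n` aligned and larger than the windows' radius),
  superlattice invariance of the window entropies, the residue count `card_filter_halfOpenBox_cellRes_eq`, and `k → ∞` along
  `IsPeriodic.tendsto_boxEntropyDensity_aligned`.
* §3 **THE MARKOV CAP ON `P_q`** (`IsPeriodic.card_cell_mul_sub_mul_le_markov`, `perVarPressure_le_of_markov`): with the exact weighted-cluster energy
  identity `Re ω(H^{Ψ^w}_B) = M·|C|·ē_q(ω) + w(∅)(Ψ∅)_{∅∅}` (`IsPeriodic.re_expect_localHamiltonian_reweight`, any `L_q`-admissible weight of mass `M`),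
  `|C|·(s̄ − β ē_q)(ω) ≤ Σ_{c∈T}[S(ω|W c) − S(ω|W c ∖ a c)] − (β/M)·(Re ω(H^{Ψ^w}_B) − w(∅)(Ψ∅)_{∅∅}) + (|C| − |T|) log 4`, so that ANY bound `c₀` on the
  cluster functional `Σ_c [S(W c) − S(W c ∖ a c)] − (β/M) Re ω(H^{Ψ^w}_B + G)` over periodic states (`G` killed by periodic states) — e.g. a
  Poulin–Hastings matrix certificate when the windows form a chain inside `B` (`FermionConditionalFreeEnergyCertificate`) — gives
  `|C|·P_q(β,Ψ) ≤ c₀ + (|C| − |T|) log 4 + (β/M) w(∅)(Ψ∅)_{∅∅}`. OVERLAPPING clusters (the `CuO₄` plus of the three-band model) are admissible: no tiling.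

Everything is PROVED (0 sorry); no definition, no named fact, no number.

## Tree / Mathlib search

REUSED: `sum_entropyIncrement`, `entropyIncrement_corner_le`, `entropyIncrement_le_log_four`, `regionEntropy` (`FermionEntropyChainRule`); `IsEven.parityAut_rdm`;
`IsPeriodic.isEven`, `IsPeriodic.vonNeumannEntropy_rdm_shiftSet_superlatVec`, `IsPeriodic.tendsto_boxEntropyDensity_aligned` (`PeriodicStatesMeanEntropy`);
`regionEntropy_rdm` (`InfVolFermionStateRegionEntropy`); `cellRes`, `eq_cellPos_cellRes_add_superlatVec`, `card_filter_halfOpenBox_cellRes_eq`, `prod_div_mul_card_cell`,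
`dvd_prod_succ` (`PeriodicInteractionsCellEnergy`, `PeriodicVariationalPressure`); `IsPeriodic.re_expect_localHamiltonian_reweight` (`WeightedOpenClusterBoundsPeriodic`);
`perVarPressure_le`; `shiftSet`, `mem_shiftSet`; Mathlib `tendsto_natCast_div_add_atTop`, `le_of_tendsto_of_tendsto'`, `Finset.sum_fiberwise_of_maps_to`.
`lean search 'entropyDensitySup.*(erase|window|cond)|Markov.*perVarPressure'` (2026-08-28): nothing — the Markov bound existed only on finite tori.

## References

* D. Poulin, M. B. Hastings, Phys. Rev. Lett. 106 (2011) 080403, eqs. (3)–(8) (Markov entropy decomposition). [cite: PoulinHastings2011, eqs. (3)–(8)]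
* H. Araki, H. Moriya, Rev. Math. Phys. 15 (2003) 93, Theorem 3.8 and §10 (SSA for even states of the Fermion algebra; mean entropy).
  [cite: ArakiMoriya2003, Theorem 3.8 and §10]
* O. Bratteli, D. W. Robinson, *OAQSM 2* (1997), Prop. 6.2.38 ff. (mean entropy as a limit of conditional entropies). [cite: BratteliRobinsonII1997, Thm. 6.2.40]
* R. B. Israel, *Convexity in the Theory of Lattice Gases* (1979), Thm. I.2.4 (variational pressure). [cite: Israel1979, Thm. I.2.4]
-/

noncomputable section

open scoped ComplexOrder BigOperators
open Finset Literature.InformationTheory.Entropy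

namespace Literature.MathematicalPhysics.QuantumLattice

open Matrix HubbardWave0 Literature.Probability.LatticeModels ThermodynamicLimit
open _root_.Filter
open scoped _root_.Topology

variable {d : ℕ}

/-! ### §1. Finite regions: the entropy is capped by the conditional entropies at a family of corner windows -/

/-- Lexicographic order and translation: `y − v ≤ a ⇒ y ≤ a + v` in `Lex (ℤ^d)`. [folklore] -/
private theorem toLex_le_toLex_add_of_sub_le {a v y : Site d} (h : toLex (y - v) ≤ toLex a) : toLex y ≤ toLex (a + v) := by
  have h' := add_le_add_right h (toLex v)
  rw [← toLex_add, ← toLex_add] at h'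
  have e2 : v + (y - v) = y := by abel
  have e3 : v + a = a + v := add_comm v a
  rw [e2, e3] at h'
  exact h'

/-- Translation by `0` is the identity on regions. [folklore] -/
private theorem shiftSet_zero' (A : Finset (Site d)) : shiftSet (0 : Site d) A = A := by
  ext y
  simp [mem_shiftSet]

/-- **THE MULTI-WINDOW MARKOV BOUND (finite region).** Let `ρ ∈ 𝔄_Ω` be an even density matrix, `K ⊆ Ω` a set of corner sites and, for each
`x ∈ K`, a window `W x ⊆ Ω` containing `x` as its lexicographically LARGEST site. Then
`S(ρ) ≤ Σ_{x ∈ K} [S_ρ(W x) − S_ρ(W x ∖ x)] + (|Ω| − |K|)·log 4` — chain rule, strong subadditivity at the corners, `log 4` at the other sites.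
[cite: PoulinHastings2011, eqs. (3)–(6)] [cite: ArakiMoriya2003, Theorem 3.8 and §10] -/
theorem vonNeumannEntropy_le_sum_cornerWindows {Ω : Finset (Site d)} (K : Finset (Site d)) (hK : K ⊆ Ω) (W : Site d → Finset (Site d))
    (hWΩ : ∀ x ∈ K, W x ⊆ Ω) (hxW : ∀ x ∈ K, x ∈ W x) (hmax : ∀ x ∈ K, ∀ y ∈ W x, toLex y ≤ toLex x)
    {ρ : FermionOp Ω} (hρ : ρ.PosSemidef) (htr : ρ.trace = 1) (hev : parityAut ρ = ρ) :
    vonNeumannEntropy ρ ≤ ∑ x ∈ K, (regionEntropy ρ (W x) - regionEntropy ρ ((W x).erase x)) + (Ω.card - K.card) * Real.log 4 := by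
  classical
  rw [← sum_entropyIncrement hρ.1 htr]
  have hCsub : lexSites K ⊆ lexSites Ω := fun x hx => mem_lexSites.2 (hK (mem_lexSites.1 hx))
  have h1 : ∑ x ∈ lexSites K, entropyIncrement ρ x ≤ ∑ x ∈ K, (regionEntropy ρ (W x) - regionEntropy ρ ((W x).erase x)) := by
    rw [lexSites, Finset.sum_map]
    refine Finset.sum_le_sum fun x hx => ?_
    have h := entropyIncrement_corner_le (hxW x hx) (hmax x hx) (v := 0) (by rw [shiftSet_zero']; exact hWΩ x hx) hρ htr hev
    rwa [add_zero, shiftSet_zero', shiftSet_zero'] at h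
  have h2 : ∑ x ∈ lexSites Ω \ lexSites K, entropyIncrement ρ x ≤ (lexSites Ω \ lexSites K).card • Real.log 4 :=
    Finset.sum_le_card_nsmul _ _ _ fun x hx => entropyIncrement_le_log_four (mem_lexSites.1 (Finset.mem_sdiff.1 hx).1) hρ htr hev
  have hcard : ((lexSites Ω \ lexSites K).card : ℝ) = Ω.card - K.card := by
    rw [Finset.card_sdiff_of_subset hCsub, Nat.cast_sub (Finset.card_le_card hCsub), lexSites, lexSites, Finset.card_map, Finset.card_map]
  rw [nsmul_eq_mul, hcard] at h2
  rw [← Finset.sum_sdiff hCsub]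
  linarith

/-! ### §2. Infinite volume: the Markov bound on the mean entropy of a periodic state -/

namespace InfVolFermionState

variable {q : Fin d → ℕ} {ω : InfVolFermionState d}

/-- Superlattice shifts do not change residues: `res(x + ℓ_q z) = res x`. [cite: ArakiMoriya2003, §4.1] -/
theorem cellRes_add_superlatVec (q : Fin d → ℕ) (x : Site d) (z : Fin d → ℤ) :
    cellRes q (x + superlatVec q z) = cellRes q x := by
  funext i
  apply Fin.ext
  simp only [cellRes, Pi.add_apply, superlatVec_apply, Int.add_mul_emod_self_right]

/-- Sites with equal residues differ by a superlattice vector. [cite: ArakiMoriya2003, §4.1] -/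
theorem sub_eq_superlatVec_of_cellRes_eq {q : Fin d → ℕ} {x y : Site d} (h : cellRes q x = cellRes q y) :
    x - y = superlatVec q (fun i => x i / ((q i : ℤ) + 1) - y i / ((q i : ℤ) + 1)) := by
  have hx := eq_cellPos_cellRes_add_superlatVec q x
  have hy := eq_cellPos_cellRes_add_superlatVec q y
  rw [h] at hx
  funext i
  have hxi := congrFun hx i
  have hyi := congrFun hy i
  simp only [Pi.add_apply, superlatVec_apply, Pi.sub_apply] at hxi hyi ⊢
  linear_combination hxi - hyi

/-- Erasing the corner commutes with translating the window: `((W + (x − b)) ∖ x) = (W ∖ b) + (x − b)`. [folklore] -/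
private theorem erase_shiftSet_sub (x b : Site d) (A : Finset (Site d)) :
    (shiftSet (x - b) A).erase x = shiftSet (x - b) (A.erase b) := by
  ext y
  simp only [Finset.mem_erase, mem_shiftSet]
  have e : y - (x - b) = b ↔ y = x := by
    constructor
    · intro h'
      have := congrArg (· + (x - b)) h'
      simp only [sub_add_cancel] at this
      rw [this]; abel
    · intro h'
      rw [h']; abel
  rw [ne_eq, ← e]

/-- **THE MARKOV BOUND ON THE MEAN ENTROPY OF A PERIODIC STATE.** Let `ω` be `q`-periodic on `ℤ^d` (`d ≥ 1`), `T` a set of residue classes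
and, for each `c ∈ T`, a corner `a c` of residue `c` with a finite window `W c ∋ a c` of which `a c` is the lexicographically largest site. Then
`|C| · s̄(ω) ≤ Σ_{c ∈ T} [S(ω|W c) − S(ω|W c ∖ a c)] + (|C| − |T|)·log 4` (`|C| = Π_i (q_i+1)`): per cell, each class in `T` contributes the
conditional entropy of its corner given the rest of its window, every other class `log 4`. The windows may overlap arbitrarily.
[cite: PoulinHastings2011, eqs. (3)–(6)] [cite: ArakiMoriya2003, Theorem 3.8 and §10] [cite: BratteliRobinsonII1997, Thm. 6.2.40] -/
theorem IsPeriodic.card_cell_mul_entropyDensitySup_le (hd : 0 < d) (hω : ω.IsPeriodic q) (T : Finset (Cell q))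
    (a : Cell q → Site d) (W : Cell q → Finset (Site d)) (hres : ∀ c ∈ T, cellRes q (a c) = c)
    (haW : ∀ c ∈ T, a c ∈ W c) (hmax : ∀ c ∈ T, ∀ y ∈ W c, toLex y ≤ toLex (a c)) :
    (Fintype.card (Cell q) : ℝ) * ω.entropyDensitySup ≤
      ∑ c ∈ T, (vonNeumannEntropy (ω.rdm (W c)) - vonNeumannEntropy (ω.rdm ((W c).erase (a c)))) +
        ((Fintype.card (Cell q) : ℝ) - T.card) * Real.log 4 := by
  classical
  -- the radius of the windows around their corners
  set r : ℕ := T.sup fun c => (W c).sup fun y => (Finset.univ : Finset (Fin d)).sup fun i => (y i - a c i).natAbs with hr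
  have hrad : ∀ c ∈ T, ∀ y ∈ W c, ∀ i, |y i - a c i| ≤ r := by
    intro c hc y hy i
    have h1 : (y i - a c i).natAbs ≤ r :=
      le_trans (le_trans (Finset.le_sup (f := fun i => (y i - a c i).natAbs) (Finset.mem_univ i))
        (Finset.le_sup (f := fun y => (Finset.univ : Finset (Fin d)).sup fun i => (y i - a c i).natAbs) hy))
        (Finset.le_sup (f := fun c => (W c).sup fun y => (Finset.univ : Finset (Fin d)).sup fun i => (y i - a c i).natAbs) hc)
    rw [← Int.natCast_natAbs]
    exact_mod_cast h1
  -- an aligned side larger than the radius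
  set L : ℕ := ∏ j, (q j + 1) with hL
  have hL0 : 0 < L := Finset.prod_pos fun j _ => Nat.succ_pos _
  set n : ℕ := L * (r + 1) with hn
  have hnq : ∀ i, (q i + 1) ∣ n := fun i => Dvd.dvd.mul_right (dvd_prod_succ q i) _
  have hn1 : 1 ≤ n := Nat.one_le_iff_ne_zero.2 (Nat.mul_ne_zero hL0.ne' (Nat.succ_ne_zero r))
  have hrn : (r : ℤ) < n := by
    have : r + 1 ≤ n := by rw [hn]; exact Nat.le_mul_of_pos_left (r + 1) hL0
    exact_mod_cast this
  have hn0 : (0 : ℝ) < n := by exact_mod_cast hn1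
  -- abbreviations
  set A : ℝ := ∑ c ∈ T, (vonNeumannEntropy (ω.rdm (W c)) - vonNeumannEntropy (ω.rdm ((W c).erase (a c)))) with hA
  set Cq : ℝ := (Fintype.card (Cell q) : ℝ) with hCq
  have hCq0 : 0 < Cq := by rw [hCq]; exact_mod_cast Fintype.card_pos
  set F : Cell q → ℝ := fun c => vonNeumannEntropy (ω.rdm (W c)) - vonNeumannEntropy (ω.rdm ((W c).erase (a c))) with hF
  -- the finite-box inequality, for every `k`
  have hbox : ∀ k : ℕ, vonNeumannEntropy (ω.rdm (halfOpenBox d ((k + 2) * n))) ≤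
      ((∏ i, (k * n / (q i + 1)) : ℕ) : ℝ) * A +
        (((((k + 2) * n : ℕ) : ℝ)) ^ d - T.card * ((∏ i, (k * n / (q i + 1)) : ℕ) : ℝ)) * Real.log 4 := by
    intro k
    have hkn : ∀ i, (q i + 1) ∣ k * n := fun i => Dvd.dvd.mul_left (hnq i) k
    -- the region `Ω = [−n, (k+1)n)^d`, a superlattice translate of the box `[0, (k+2)n)^d`
    set p : Fin d → ℤ := fun i => -(((n / (q i + 1) : ℕ) : ℤ)) with hp
    have hvi : ∀ i, superlatVec q p i = -(n : ℤ) := by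
      intro i
      have h := Nat.div_mul_cancel (hnq i)
      simp only [hp, superlatVec_apply, neg_mul]
      congr 1
      exact_mod_cast h
    set Ω : Finset (Site d) := shiftSet (superlatVec q p) (halfOpenBox d ((k + 2) * n)) with hΩ
    have hmemΩ : ∀ x : Site d, x ∈ Ω ↔ ∀ i, -(n : ℤ) ≤ x i ∧ x i < (k + 1) * n := by
      intro x
      rw [hΩ, mem_shiftSet, mem_halfOpenBox]
      refine forall_congr' fun i => ?_
      simp only [Pi.sub_apply, hvi, sub_neg_eq_add]
      push_cast
      constructor <;> rintro ⟨h1, h2⟩ <;> constructor <;> linarith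
    have hSΩ : vonNeumannEntropy (ω.rdm Ω) = vonNeumannEntropy (ω.rdm (halfOpenBox d ((k + 2) * n))) :=
      hω.vonNeumannEntropy_rdm_shiftSet_superlatVec p _
    -- corners: the sites of `[0,kn)^d` with residue in `T`; windows: the translated `W`
    set K : Finset (Site d) := (halfOpenBox d (k * n)).filter fun x => cellRes q x ∈ T with hK
    set Wx : Site d → Finset (Site d) := fun x => shiftSet (x - a (cellRes q x)) (W (cellRes q x)) with hWx
    have hKΩ : K ⊆ Ω := by
      intro x hx
      have hx' := mem_halfOpenBox.1 (Finset.mem_filter.1 hx).1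
      rw [hmemΩ]
      intro i
      have := hx' i
      push_cast at this
      constructor <;> nlinarith [this.1, this.2, hn0]
    have hWΩ : ∀ x ∈ K, Wx x ⊆ Ω := by
      intro x hx y hy
      have hc := (Finset.mem_filter.1 hx).2
      have hx' := mem_halfOpenBox.1 (Finset.mem_filter.1 hx).1
      have hy' : y - (x - a (cellRes q x)) ∈ W (cellRes q x) := mem_shiftSet.1 hy
      rw [hmemΩ]
      intro i
      have h1 := hrad _ hc _ hy' i
      have h2 := hx' i
      simp only [Pi.sub_apply] at h1
      rw [abs_le] at h1
      push_cast at h2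
      constructor <;> nlinarith [h1.1, h1.2, h2.1, h2.2, hrn]
    have hxW : ∀ x ∈ K, x ∈ Wx x := by
      intro x hx
      have hc := (Finset.mem_filter.1 hx).2
      show x ∈ shiftSet (x - a (cellRes q x)) (W (cellRes q x))
      rw [mem_shiftSet, sub_sub_cancel]
      exact haW _ hc
    have hmaxK : ∀ x ∈ K, ∀ y ∈ Wx x, toLex y ≤ toLex x := by
      intro x hx y hy
      have hc := (Finset.mem_filter.1 hx).2
      have hy' : y - (x - a (cellRes q x)) ∈ W (cellRes q x) := mem_shiftSet.1 hy
      have h := toLex_le_toLex_add_of_sub_le (hmax _ hc _ hy')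
      rwa [add_sub_cancel] at h
    have hev : parityAut (ω.rdm Ω) = ω.rdm Ω := (hω.isEven hd).parityAut_rdm _
    have h1 := vonNeumannEntropy_le_sum_cornerWindows K hKΩ Wx hWΩ hxW hmaxK (ω.rdm_posSemidef Ω) (ω.trace_rdm Ω) hev
    -- the window entropies are those of `W c`, by superlattice invariance
    have hWval : ∀ x ∈ K, regionEntropy (ω.rdm Ω) (Wx x) - regionEntropy (ω.rdm Ω) ((Wx x).erase x) = F (cellRes q x) := by
      intro x hx
      have hc := (Finset.mem_filter.1 hx).2
      have hz := sub_eq_superlatVec_of_cellRes_eq ((hres _ hc).symm ▸ rfl : cellRes q x = cellRes q (a (cellRes q x)))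
      have hsub1 : Wx x ⊆ Ω := hWΩ x hx
      have hsub2 : (Wx x).erase x ⊆ Ω := (Finset.erase_subset _ _).trans hsub1
      rw [ω.regionEntropy_rdm hsub1, ω.regionEntropy_rdm hsub2]
      show vonNeumannEntropy (ω.rdm (shiftSet (x - a (cellRes q x)) (W (cellRes q x)))) -
          vonNeumannEntropy (ω.rdm ((shiftSet (x - a (cellRes q x)) (W (cellRes q x))).erase x)) = F (cellRes q x)
      rw [erase_shiftSet_sub, hz, hω.vonNeumannEntropy_rdm_shiftSet_superlatVec, hω.vonNeumannEntropy_rdm_shiftSet_superlatVec]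
    -- counting the corners of each class
    have hfib : ∀ c ∈ T, (K.filter fun x => cellRes q x = c).card = ∏ i, (k * n / (q i + 1)) := by
      intro c hc
      rw [hK, Finset.filter_filter]
      have e : ((halfOpenBox d (k * n)).filter fun x => cellRes q x ∈ T ∧ cellRes q x = c) =
          (halfOpenBox d (k * n)).filter fun x => cellRes q x = c := by
        refine Finset.filter_congr fun x _ => ⟨fun h => h.2, fun h => ⟨?_, h⟩⟩
        rw [h]; exact hc
      rw [e, card_filter_halfOpenBox_cellRes_eq q hkn c]
    have hmaps : ∀ x ∈ K, cellRes q x ∈ T := fun x hx => (Finset.mem_filter.1 hx).2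
    have hsum : ∑ x ∈ K, (regionEntropy (ω.rdm Ω) (Wx x) - regionEntropy (ω.rdm Ω) ((Wx x).erase x)) =
        ((∏ i, (k * n / (q i + 1)) : ℕ) : ℝ) * A := by
      rw [Finset.sum_congr rfl hWval, ← Finset.sum_fiberwise_of_maps_to hmaps, hA, Finset.mul_sum]
      refine Finset.sum_congr rfl fun c hc => ?_
      rw [Finset.sum_congr rfl fun x hx => by rw [(Finset.mem_filter.1 hx).2], Finset.sum_const, hfib c hc, nsmul_eq_mul]
    have hcardK : (K.card : ℝ) = T.card * ((∏ i, (k * n / (q i + 1)) : ℕ) : ℝ) := by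
      rw [Finset.card_eq_sum_card_fiberwise hmaps, Nat.cast_sum, Finset.sum_congr rfl fun c hc => by rw [hfib c hc], Finset.sum_const,
        nsmul_eq_mul]
    have hcardΩ : (Ω.card : ℝ) = ((((k + 2) * n : ℕ) : ℝ)) ^ d := by
      rw [hΩ, card_shiftSet, card_halfOpenBox]
      push_cast
      ring
    rw [hsum, hcardK, hcardΩ, hSΩ] at h1
    exact h1
  -- normalisation: `Π_i kn/(q_i+1) = (kn)^d / |C|`
  have hNk : ∀ k : ℕ, ((∏ i, (k * n / (q i + 1)) : ℕ) : ℝ) * Cq = ((k : ℝ) * n) ^ d := by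
    intro k
    have h := prod_div_mul_card_cell q (n := k * n) fun i => Dvd.dvd.mul_left (hnq i) k
    rw [hCq]
    exact_mod_cast h
  -- the box inequality in density form
  set f : ℕ → ℝ := fun k => ((k : ℝ) / ((k : ℝ) + 2)) ^ d with hf
  have hdens : ∀ k : ℕ, ω.boxEntropyDensity ((k + 2) * n) ≤ f k / Cq * A + (1 - T.card * (f k / Cq)) * Real.log 4 := by
    intro k
    have hV : (0 : ℝ) < ((((k + 2) * n : ℕ) : ℝ)) ^ d := by positivity
    have hfV : f k * ((((k + 2) * n : ℕ) : ℝ)) ^ d = ((k : ℝ) * n) ^ d := by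
      rw [hf]
      push_cast
      rw [← mul_pow]
      congr 1
      field_simp
    have hNkV : ((∏ i, (k * n / (q i + 1)) : ℕ) : ℝ) = f k / Cq * ((((k + 2) * n : ℕ) : ℝ)) ^ d := by
      rw [div_mul_eq_mul_div, hfV, eq_div_iff hCq0.ne', hNk k]
    rw [boxEntropyDensity_apply, div_le_iff₀ hV]
    have e : (f k / Cq * A + (1 - T.card * (f k / Cq)) * Real.log 4) * ((((k + 2) * n : ℕ) : ℝ)) ^ d =
        ((∏ i, (k * n / (q i + 1)) : ℕ) : ℝ) * A +
          (((((k + 2) * n : ℕ) : ℝ)) ^ d - T.card * ((∏ i, (k * n / (q i + 1)) : ℕ) : ℝ)) * Real.log 4 := by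
      rw [hNkV]
      ring
    rw [e]
    exact hbox k
  -- `k → ∞`
  have hflim : Tendsto f atTop (𝓝 1) := by
    have h := (tendsto_natCast_div_add_atTop (2 : ℝ)).pow d
    rw [one_pow] at h
    exact h
  have hR : Tendsto (fun k => f k / Cq * A + (1 - T.card * (f k / Cq)) * Real.log 4) atTop
      (𝓝 (1 / Cq * A + (1 - T.card * (1 / Cq)) * Real.log 4)) :=
    ((hflim.div_const Cq).mul_const A).add ((tendsto_const_nhds.sub ((hflim.div_const Cq).const_mul _)).mul_const _)
  have hLHS : Tendsto (fun k => ω.boxEntropyDensity ((k + 2) * n)) atTop (𝓝 ω.entropyDensitySup) :=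
    hω.tendsto_boxEntropyDensity_aligned hd (ns := fun k => (k + 2) * n)
      (tendsto_atTop_mono (fun k => (Nat.le_add_right k 2).trans (Nat.le_mul_of_pos_right (k + 2) hn1)) tendsto_id)
      (fun k i => Dvd.dvd.mul_left (hnq i) _)
  have hle := le_of_tendsto_of_tendsto' hLHS hR hdens
  have hmul := mul_le_mul_of_nonneg_left hle hCq0.le
  have e : Cq * (1 / Cq * A + (1 - T.card * (1 / Cq)) * Real.log 4) = A + (Cq - T.card) * Real.log 4 := by
    field_simp
  rw [e] at hmul
  exact hmul

/-! ### §3. The Markov cap on the periodic variational pressure -/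

/-- **THE MARKOV BOUND ON THE PERIODIC VARIATIONAL FUNCTIONAL.** With the data of `card_cell_mul_entropyDensitySup_le`, a `q`-periodic `Ψ` of finite
range `R`, a window `B` and an `L_q`-admissible weight `w` of mass `M ≠ 0` (so that `Re ω(H^{Ψ^w}_B) = M·|C|·ē_q(ω) + w(∅)(Ψ∅)_{∅∅}` exactly), for
every `q`-periodic `ω` and real `β`:
`|C|·(s̄(ω) − β ē_q(ω)) ≤ Σ_{c ∈ T} [S(ω|W c) − S(ω|W c ∖ a c)] − (β/M)·(Re ω(H^{Ψ^w}_B) − w(∅)(Ψ∅)_{∅∅}) + (|C| − |T|)·log 4`.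
[cite: PoulinHastings2011, eqs. (3)–(8)] [cite: ValentiStolzeHirschfeld1991, §II] -/
theorem IsPeriodic.card_cell_mul_sub_mul_le_markov (hd : 0 < d) (hω : ω.IsPeriodic q) {Ψ : FermionInteraction d} {R : ℝ}
    (hΨ : Ψ.IsPeriodic q) (hR : Ψ.HasFiniteRange R) (T : Finset (Cell q)) (a : Cell q → Site d) (W : Cell q → Finset (Site d))
    (hres : ∀ c ∈ T, cellRes q (a c) = c) (haW : ∀ c ∈ T, a c ∈ W c) (hmax : ∀ c ∈ T, ∀ y ∈ W c, toLex y ≤ toLex (a c))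
    (B : Finset (Site d)) (w : Finset (Site d) → ℝ) {M : ℝ} (hM : M ≠ 0)
    (hw : ∀ (c : Cell q) (X : Finset (Site d)), cellPos c ∈ X → Ψ.Φ X ≠ 0 →
      ∑ y ∈ B with (cellRes q y = c ∧ shiftSet (y - cellPos c) X ⊆ B), w (shiftSet (y - cellPos c) X) = M) (β : ℝ) :
    (Fintype.card (Cell q) : ℝ) * (ω.entropyDensitySup - β * cellMeanEnergy q Ψ ω R) ≤
      ∑ c ∈ T, (vonNeumannEntropy (ω.rdm (W c)) - vonNeumannEntropy (ω.rdm ((W c).erase (a c)))) -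
        β / M * ((ω.expect B ((⟨fun X => (w X : ℂ) • Ψ.Φ X⟩ : FermionInteraction d).localHamiltonian B)).re - w ∅ * ((Ψ.Φ ∅) ∅ ∅).re) +
        ((Fintype.card (Cell q) : ℝ) - T.card) * Real.log 4 := by
  have hS := hω.card_cell_mul_entropyDensitySup_le hd T a W hres haW hmax
  have hE := hω.re_expect_localHamiltonian_reweight hΨ hR B w M hw
  have e : β / M * ((ω.expect B ((⟨fun X => (w X : ℂ) • Ψ.Φ X⟩ : FermionInteraction d).localHamiltonian B)).re - w ∅ * ((Ψ.Φ ∅) ∅ ∅).re) =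
      β * ((Fintype.card (Cell q) : ℝ) * cellMeanEnergy q Ψ ω R) := by
    rw [hE]
    field_simp
    ring
  rw [e, mul_sub]
  linarith

end InfVolFermionState

namespace FermionInteraction

open InfVolFermionState

variable {q : Fin d → ℕ} {Ψ : FermionInteraction d} {R : ℝ}

/-- **THE MARKOV CAP ON `P_q`.** Same data; `G ∈ 𝔄_B` killed by every `q`-periodic state. If the CLUSTER FUNCTIONAL is bounded over periodic states,
`Σ_{c ∈ T} [S(ω|W c) − S(ω|W c ∖ a c)] − (β/M)·Re ω(H^{Ψ^w}_B + G) ≤ c₀` — for windows forming a chain inside `B` this is one Poulin–Hastings matrix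
certificate (`fermion_condFreeEnergy_le_of_certificate_of_split`) — then `|C|·P_q(β,Ψ,R) ≤ c₀ + (|C| − |T|)·log 4 + (β/M)·w(∅)(Ψ∅)_{∅∅}`.
[cite: PoulinHastings2011, eqs. (3)–(8)] [cite: Israel1979, Thm. I.2.4] -/
theorem perVarPressure_le_of_markov (hd : 0 < d) (hΨ : Ψ.IsPeriodic q) (hR : Ψ.HasFiniteRange R) (T : Finset (Cell q)) (a : Cell q → Site d)
    (W : Cell q → Finset (Site d)) (hres : ∀ c ∈ T, cellRes q (a c) = c) (haW : ∀ c ∈ T, a c ∈ W c)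
    (hmax : ∀ c ∈ T, ∀ y ∈ W c, toLex y ≤ toLex (a c)) (B : Finset (Site d)) (w : Finset (Site d) → ℝ) {M : ℝ} (hM : M ≠ 0)
    (hw : ∀ (c : Cell q) (X : Finset (Site d)), cellPos c ∈ X → Ψ.Φ X ≠ 0 →
      ∑ y ∈ B with (cellRes q y = c ∧ shiftSet (y - cellPos c) X ⊆ B), w (shiftSet (y - cellPos c) X) = M)
    {G : FermionOp B} (hG0 : ∀ ω' : InfVolFermionState d, ω'.IsPeriodic q → (ω'.expect B G).re = 0) (β : ℝ) {c₀ : ℝ}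
    (hvar : ∀ ω : InfVolFermionState d, ω.IsPeriodic q →
      ∑ c ∈ T, (vonNeumannEntropy (ω.rdm (W c)) - vonNeumannEntropy (ω.rdm ((W c).erase (a c)))) -
        β / M * (ω.expect B ((⟨fun X => (w X : ℂ) • Ψ.Φ X⟩ : FermionInteraction d).localHamiltonian B + G)).re ≤ c₀) :
    (Fintype.card (Cell q) : ℝ) * Ψ.perVarPressure β q R ≤
      c₀ + ((Fintype.card (Cell q) : ℝ) - T.card) * Real.log 4 + β / M * (w ∅ * ((Ψ.Φ ∅) ∅ ∅).re) := by
  have hC : (0 : ℝ) < Fintype.card (Cell q) := by exact_mod_cast Fintype.card_pos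
  rw [← le_div_iff₀' hC]
  refine Ψ.perVarPressure_le β q R fun ω hω => ?_
  rw [le_div_iff₀' hC]
  have h1 := hω.card_cell_mul_sub_mul_le_markov hd hΨ hR T a W hres haW hmax B w hM hw β
  have h2 := hvar ω hω
  rw [map_add, Complex.add_re, hG0 ω hω, add_zero] at h2
  have e : β / M * ((ω.expect B ((⟨fun X => (w X : ℂ) • Ψ.Φ X⟩ : FermionInteraction d).localHamiltonian B)).re - w ∅ * ((Ψ.Φ ∅) ∅ ∅).re) =
      β / M * (ω.expect B ((⟨fun X => (w X : ℂ) • Ψ.Φ X⟩ : FermionInteraction d).localHamiltonian B)).re - β / M * (w ∅ * ((Ψ.Φ ∅) ∅ ∅).re) :=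
    mul_sub _ _ _
  linarith

end FermionInteraction

end Literature.MathematicalPhysics.QuantumLattice

end
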